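import Literature.NumberTheory.EllipticCurves.Kim2025.CorankStructureOPEN
import Literature.NumberTheory.EllipticCurves.Kim2026.ShaTrivialityRankCertificate
import HarnessLib

/-!
# Kim–Pollack's "elliptic curves of high rank" certificate at EVERY prime `p ≥ 3` under large image,
# as a PROVED implication from the OPEN clauses of Kim 2025 Thm. 1.1 / Cor. 1.11

Topic `NumberTheory/EllipticCurves`, sub-directory `Kim2025` (namespace = path). THEOREMS ONLY (net
debt `0`): the `p ≥ 3`, large-image twin of `Kim2026/ShaTrivialityRankCertificate` (which composes the
PUBLISHED `p ≥ 5` good-ordinary facts), with the two Kim-inputs replaced by the OPEN `Prop`s of the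
UNREFEREED preprint typed in `Kim2025/CorankStructureOPEN` and `Kim2025/StructureClauseOPEN` —
`cor111_selmerCorank_le_of_kuriharaNumber_ne_zero_OPEN` (Cor. 1.11) and
`thm11_kimShaLength_of_integralPeriod_OPEN` (Thm. 1.1 ("BSD") length clause) — taken as explicit
hypotheses `(h111 : …) (h11 : …)`. Nothing is asserted: every theorem is conditional on those
announced claims `[claim: Kim2025RefinedTNC, status: under-review]`; at a good ordinary `p ≥ 5` use
the sibling's published version instead. Written by the cross-ladder literature-typing layer (cell
`bsd-littype`, seat 09; OPEN-QUESTIONS-09 Q9). HONEST FRAMING (cell, verbatim): "no tranche here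
proves BSD … typed ≠ proved ≠ endorsed".

## The printed use (C.-H. Kim–R. Pollack, appendix to arXiv:2505.09121v1, §A.1.5, held TeX text
`paper:arxiv-2505.09121` chunk p0027:L28–L80)

"The following computation confirms the triviality of the `p`-primary part of Tate–Shafarevich
groups for several elliptic curves of rank `≥ 2`. These high rank examples cannot be obtained from
any known result on Birch and Swinnerton-Dyer conjecture." Rows at `p = 3` (any reduction type):
`389.a1`, `433.a1`, `563.a1`, `571.a1`, `643.a1` (good ordinary), `446.a1` (good supersingular) —
rank `2`, `δ̃_{ℓ₁ℓ₂} ≠ 0`, `Sel(ℚ, E[3^∞]) ≅ (ℚ₃/ℤ₃)^{⊕2}`; `11197.a1`, `11642.a1`, `16811.a1`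
(supersingular), `12279.a1` (non-split multiplicative), `13766.a1`, `18097.a1` — rank `3`;
`234446.a1`, `501029.a1`, `545723.a1` — rank `4`. Each row is ONE unit Kurihara number at a level
with `ν(n) = rank`; the theorems below are the kernel shape of "row ⇒ `Ш(E/ℚ)[3^∞] = 0`", granted
the announced Thm. 1.1 / Cor. 1.11 (and, for the `#Ш = 1` form, `Ш(E/ℚ)` finite).

## The argument

Identical to `Kim2026/ShaTrivialityRankCertificate` (module docstring there): Cor. 1.11 bounds
`cork ≤ ν(n)`; the corank identity gives `rank ≤ cork`; with `ν(n) ≤ rank`, `rank = cork = ν(n)` and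
`corank Ш[p^∞] = 0`; `ord(δ̃) = ν(n)` over the cyclic levels (unit at `n`; any non-vanishing cyclic
level `m` carries a certificate mod `p^k`, `exists_kuriharaNumber_ne_zero_of_kuriharaDivIndex_lt_top`,
and bounds `cork`); the length clause at `ord = ν(n)` with `∂^{(ν(n))} = 0` gives
`ord_p #Ш(E/ℚ)(p) = 0`, hence `#Ш(E/ℚ)(p) = 1` (finite `p`-group). Binders = those of the OPEN
`Prop`s: `p ≥ 3`, tower `ρ̄_{E,p^m}` onto for all `m`, newform `f` of `W` with `Ω⁺_f` an integral
period, cyclic level, surjective `ψ`.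

## References
* C.-H. Kim (app. with R. Pollack), arXiv:2505.09121v1 (2025): Thm. 1.1 ("BSD"), Cor. 1.11, App. A.1.5.
  [Kim2025RefinedTNC]
* C.-H. Kim, Amer. J. Math. 148 (2026) 79–129: Thm. 1.8 (1), (6), Cor. 1.13 (the published `p ≥ 5`
  shape, sibling file). [Kim2022StructureSelmer]
* R. Greenberg, LNM 1716 (1999), §1 (corank identity). [Greenberg1999]
-/

noncomputable section

open scoped MatrixGroups ModularForm Classical

open CongruenceSubgroup Literature.NumberTheory.EllipticCurves.ModularForms
  Literature.NumberTheory.EllipticCurves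

namespace Literature.NumberTheory.EllipticCurves.Kim2025

section Certificate

variable (W : WeierstrassCurve ℚ) [W.IsElliptic] [W.IsGloballyMinimal] (p : ℕ) [Fact p.Prime]
  (hp : 3 ≤ p) (htower : ∀ m : ℕ, W.HasSurjectiveModNGaloisRep (p ^ m : ℕ))
  {N : ℕ} [NeZero N] (f : CuspForm (Gamma0 N) 2) (hf : IsNewformOf W f)
  (hint : ∀ r : ℚ, ratPlusSymbol f r ≠ 0 → 0 ≤ padicValRat p (ratPlusSymbol f r))
  {n : ℕ} [NeZero n] (hn : IsCyclicKolyvaginLevel W p n)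
  (ψ : (ℓ : ℕ) → (ZMod ℓ)ˣ →* Multiplicative (ZMod (p ^ 1)))
  (hψ : ∀ ℓ ∈ n.primeFactors, Function.Surjective (ψ ℓ))
  (hne : kuriharaNumber f (p ^ 1) n ψ ≠ 0)
  (hrank : n.primeFactors.card ≤ W.mordellWeilRank)

include hp htower hf hint hn hψ hne hrank

/-- **Rank and corank from one unit Kurihara number and `ν(n)` points, at every `p ≥ 3` under large
image — granted the OPEN Cor. 1.11** (`h111`): `rank E(ℚ) = ν(n)`, `corank_{ℤ_p} Sel_{p^∞}(E/ℚ) =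
ν(n)`, `corank_{ℤ_p} Ш(E/ℚ)[p^∞] = 0`; no finiteness of `Ш` assumed. Conditional on an unrefereed
claim; at a good ordinary `p ≥ 5` use `Kim2026.rank_eq_card_primeFactors_of_kuriharaNumber_ne_zero`.
[cite: Kim2025RefinedTNC, Cor. 1.11 (§1.3.5, held chunk p0007:L28–L31), App. A.1.5 (chunk p0027) (ANNOUNCED; hypothesis `h111` is an OPEN Prop)]
[cite: Greenberg1999, §1 (corank identity)] -/
theorem rank_eq_card_primeFactors_of_kuriharaNumber_ne_zero_of_OPEN
    (h111 : cor111_selmerCorank_le_of_kuriharaNumber_ne_zero_OPEN) :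
    W.mordellWeilRank = n.primeFactors.card ∧ W.selmerCorank p = n.primeFactors.card ∧
      W.shaCorank p = 0 := by
  have hcork : W.selmerCorank p ≤ n.primeFactors.card :=
    h111 W p hp htower f hf hint 1 n le_rfl hn.1 hn.2 ψ hψ hne
  have hid := W.selmerCorank_eq_mordellWeilRank_add_holds p
  omega

/-- **`Ш(E/ℚ)[p^∞]` is finite** under the same hypotheses (granted the OPEN Cor. 1.11).
[cite: Kim2025RefinedTNC, Cor. 1.11 (§1.3.5, held chunk p0007:L28–L31) (ANNOUNCED; hypothesis `h111` is an OPEN Prop)]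
[cite: Greenberg1999, §1] -/
theorem finite_primaryComponent_sha_of_kuriharaNumber_ne_zero_of_OPEN
    (h111 : cor111_selmerCorank_le_of_kuriharaNumber_ne_zero_OPEN) :
    Finite (AddCommGroup.primaryComponent W.sha p) :=
  (finite_primaryComponent_sha_iff_shaCorank_eq_zero W p).2
    (rank_eq_card_primeFactors_of_kuriharaNumber_ne_zero_of_OPEN W p hp htower f hf hint hn ψ
      hψ hne hrank h111).2.2

/-- **`ord(δ̃) = ν(n)`** over the cyclic levels (granted the OPEN Cor. 1.11): the unit at `n` bounds
`ord` above; every non-vanishing cyclic level `m` carries a certificate mod `p^k` and bounds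
`cork = ν(n)` by `ν(m)`. [cite: Kim2025RefinedTNC, Cor. 1.11 and §1.1.3 (ANNOUNCED; hypothesis `h111` is an OPEN Prop)] -/
theorem kuriharaVanishingOrder_eq_card_primeFactors_of_kuriharaNumber_ne_zero_of_OPEN
    (h111 : cor111_selmerCorank_le_of_kuriharaNumber_ne_zero_OPEN) :
    kuriharaVanishingOrder W p f = n.primeFactors.card := by
  have hcork := (rank_eq_card_primeFactors_of_kuriharaNumber_ne_zero_of_OPEN W p hp htower f
    hf hint hn ψ hψ hne hrank h111).2.1
  apply le_antisymm
  · have h0 : kuriharaDivIndex W p f n < ⊤ := by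
      rw [kuriharaDivIndex_eq_zero_of_ne_zero W p f hn.1 ψ hψ hne]
      exact ENat.coe_lt_top 0
    exact iInf_le_of_le n (iInf_le_of_le hn (iInf_le_of_le h0 le_rfl))
  · refine le_iInf fun m => le_iInf fun hm => le_iInf fun hlt => ?_
    obtain ⟨k, hk, hk1, ψ', hψ', hne'⟩ :=
      Kim2026.exists_kuriharaNumber_ne_zero_of_kuriharaDivIndex_lt_top W p f hlt
    haveI : NeZero m := ⟨hk.ne_zero⟩
    have hle : W.selmerCorank p ≤ m.primeFactors.card :=
      h111 W p hp htower f hf hint k m hk1 hk hm.2 ψ' hψ' hne'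
    rw [hcork] at hle
    exact_mod_cast hle

/-- **`Ш(E/ℚ)[p^∞] = 0` from one unit Kurihara number at level `ν(n) = rank`, at every `p ≥ 3` under
large image — granted the OPEN Cor. 1.11 (`h111`) and the OPEN length clause of Thm. 1.1 (`h11`)**,
plus `Ш(E/ℚ)` finite (binder of `h11`): `#Ш(E/ℚ)(p) = 1`. This is the kernel shape of each rank-`≥ 2`
row of Kim–Pollack App. A.1.5 at `p = 3` (e.g. `389.a1`, `δ̃_{79·109} ≠ 0`); conditional on the
unrefereed claims. At a good ordinary `p ≥ 5` use
`Kim2026.card_primaryComponent_sha_eq_one_of_kuriharaNumber_ne_zero` (published inputs).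
[cite: Kim2025RefinedTNC, Thm. 1.1 ("BSD") and Cor. 1.11, App. A.1.5 (held chunks p0004, p0007, p0027) (ANNOUNCED; hypotheses `h111`, `h11` are OPEN Props)] -/
theorem card_primaryComponent_sha_eq_one_of_kuriharaNumber_ne_zero_of_OPEN
    (h111 : cor111_selmerCorank_le_of_kuriharaNumber_ne_zero_OPEN)
    (h11 : thm11_kimShaLength_of_integralPeriod_OPEN) (hfin : Finite W.sha) :
    Nat.card (AddCommGroup.primaryComponent W.sha p) = 1 := by
  have hord' := kuriharaVanishingOrder_eq_card_primeFactors_of_kuriharaNumber_ne_zero_of_OPEN W p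
    hp htower f hf hint hn ψ hψ hne hrank h111
  obtain ⟨d, -, hpart⟩ := h11 W p hp htower hfin f hf hint n.primeFactors.card hord'
  have hzero : kuriharaPartial W p f n.primeFactors.card = 0 :=
    kuriharaPartial_eq_zero_of_ne_zero W p f hn rfl ψ hψ hne
  rw [hzero] at hpart
  have hv : padicValNat p (Nat.card (AddCommGroup.primaryComponent W.sha p)) + d = 0 := by
    exact_mod_cast hpart.symm
  haveI : Finite (AddCommGroup.primaryComponent W.sha p) := inferInstance
  obtain ⟨m, hm⟩ := exists_card_addPrimaryComponent_eq_pow (A := W.sha) p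
  rw [hm] at hv ⊢
  rw [padicValNat.prime_pow] at hv
  have hm0 : m = 0 := by omega
  rw [hm0, pow_zero]

end Certificate

end Literature.NumberTheory.EllipticCurves.Kim2025

end
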